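import Mathlib
import HarnessLib
import Summits.Ventures.LatticeQCDFlow.Scoring.PairedDrawAcceptance
import Summits.Ventures.LatticeQCDFlow.Scoring.ModelDensityPairLaw
import Summits.Ventures.LatticeQCDFlow.Scoring.UStatisticProjectionsIntegral

/-!
# LatticeQCDFlow / Scoring — the EXACT variance of the all-pairs acceptance estimator on a general
# space and its SHARP ceiling-free envelope `Var Û ≤ (2(1 − a²) + 4(n − 2)·a(1 − a))/(n(n − 1))`

HONEST FRAMING: exact (Metropolis-corrected) sampling algorithms for lattice gauge theory;
figures of merit are autocorrelation/cost numbers at stated couplings and volumes; no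
continuum-physics claim.

Venture `LatticeQCDFlow` (cell pub-lqcd), sub-topic `Scoring`; FANOUT row 3 (`s0-u1-a`, S0-B
implementation A, GEN-10).  NEW WORK of the cell (elementary), the general-space form of row 3's
`Scoring/PairAcceptanceVarianceSharp` (GEN-8, finite configuration spaces): Hoeffding's exact law
(`Scoring/UStatisticVarianceIntegral`) and its projections (`Scoring/UStatisticProjectionsIntegral`,
imported) fed with the pair facts of row 4's `Scoring/PairedDrawAcceptance` (imported), in the
setting of row 4's `Scoring/AllPairsAcceptance`: a reference measure `μ` on any measurable space
`X`, a target density `p ≥ 0` (`∫ p dμ = 1`) and a model density `q > 0`, `n` mutually independent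
model draws `x_i : Ω → X` with law `q dμ` on an abstract probability space, importance ratios
`w = p/q`, and the all-pairs (order-2 U-statistic) estimator of the equilibrium acceptance
`a = acc(p, q) = ∫∫ min(p(a)q(b), p(b)q(a)) dμ dμ` of the flow (independence Metropolis) sampler,
`Û = Σ_{i ≠ j} min(w(x_i), w(x_j)) / (n(n − 1))`.  NO weight ceiling is assumed anywhere (row 4's
exponential certificates need `p ≤ Wq`; the second-moment law does not); NO definition is
introduced.

* (the model pair law `(q dμ) ⊗ (q dμ) = (q ⊗ q) d(μ ⊗ μ)` and its dictionary are row 3's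
  `Scoring/ModelDensityPairLaw`, imported;)
* §1 the kernel `min(w, w′)` under the model pair law: **`memLp_pairMin_two`** (`∈ L²`, dominated
  by `w ⊗ w` of mean `(∫p)² = 1`), `integral_pairMin_withDensity_eq_meanAccept` (`μ_F = a`),
  `integral_sq_pairMin_withDensity_le_one` (`c₂ ≤ 1`), `condMean_pairMin_mem_Icc`
  (`0 ≤ h ≤ 1`), `integral_condMean_sq_pairMin_le_meanAccept` (`c₁ ≤ a`) and
  `meanAccept_mem_Icc` (`0 ≤ a ≤ 1`, via `a² ≤ c₁ ≤ a`);
* §2 **`variance_allPairs_eq`** — `Var[Û] = (2(c₂ − a²) + 4(n − 2)(c₁ − a²))/(n(n − 1))` EXACTLY,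
  **`variance_allPairs_le_sharp`** — `Var[Û] ≤ (2(1 − a²) + 4(n − 2)·a(1 − a))/(n(n − 1))` for
  EVERY flow on EVERY space, `variance_allPairs_le_sharp'` — the clean forms
  `≤ 4a(1 − a)/n + 2(1 − a²)/(n(n − 1)) ≤ (n + 1)/(n(n − 1))`, and **`chebyshev_allPairs_sharp`** —
  `P(|Û − a| ≥ t) ≤ (n + 1)/(n(n − 1)t²)`, ceiling-free (`…_real` in `P.real` form), and the
  two-code comparison **`acceptance_AB_allPairs_chebyshev`** (row 4's
  `acceptance_AB_allPairs_confidence` at Chebyshev level, with no ceiling on either code).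
  Sharpness (equality for the hit-or-miss flow at every `n`, `a`) is row 3's finite
  `Scoring/PairAcceptanceVarianceSharp` (`exists_variance_pairMin_eq_sharp`), not restated.

Reading (value-free): on any configuration space, the all-pairs acceptance estimate read off `n`
fresh proposals of ANY flow has standard deviation at most `√((n + 1)/(n − 1))/√n`, and
`≈ √(4a(1 − a)/n)` once `a` is roughly known, with no weight ceiling and no finiteness assumption.
NOT CLAIMED: exponential tails without a ceiling (impossible in general); the self-normalised
ratio monitor; the realised acceptance RATE of a finite chain; any number re-scored.
-/

namespace Summit.Ventures.LatticeQCDFlow.Scoring.AllPairsVariance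

open MeasureTheory ProbabilityTheory Finset

variable {Ω : Type*} [MeasurableSpace Ω] {P : Measure Ω} [IsProbabilityMeasure P]
variable {X : Type*} [MeasurableSpace X] {μ : Measure X} [SFinite μ] {n : ℕ}

/-! ## §1 The kernel `min(w, w′)` under the model pair law -/

omit [SFinite μ] in
/-- `min(w, w′)²·(q ⊗ q) ∈ L¹(μ ⊗ μ)`: dominated by `p ⊗ p`. [ours] -/
theorem integrable_sq_pairMin_mul {p q : X → ℝ} (hp0 : ∀ y, 0 ≤ p y) (hpm : Measurable p)
    (hpi : Integrable p μ) (hq0 : ∀ y, 0 < q y) (hqm : Measurable q) :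
    Integrable (fun z : X × X => min (p z.1 / q z.1) (p z.2 / q z.2) ^ 2 * (q z.1 * q z.2))
      (μ.prod μ) := by
  refine Integrable.mono' (hpi.mul_prod hpi)
    (((PairedDraws.measurable_pairMin hpm hqm).pow_const 2).mul
      ((hqm.comp measurable_fst).mul (hqm.comp measurable_snd))).aestronglyMeasurable
    (Filter.Eventually.of_forall fun z => ?_)
  have hnn : 0 ≤ min (p z.1 / q z.1) (p z.2 / q z.2) ^ 2 * (q z.1 * q z.2) :=
    mul_nonneg (sq_nonneg _) (mul_nonneg (hq0 _).le (hq0 _).le)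
  rw [Real.norm_of_nonneg hnn]
  calc min (p z.1 / q z.1) (p z.2 / q z.2) ^ 2 * (q z.1 * q z.2)
      ≤ (p z.1 / q z.1) * (p z.2 / q z.2) * (q z.1 * q z.2) :=
        mul_le_mul_of_nonneg_right (PairedDraws.sq_pairMin_le_mul hp0 hq0 z)
          (mul_nonneg (hq0 _).le (hq0 _).le)
    _ = p z.1 * p z.2 := by field_simp [(hq0 z.1).ne', (hq0 z.2).ne']

/-- **`min(w, w′) ∈ L²((q dμ) ⊗ (q dμ))`** — no weight ceiling needed. [ours] -/
theorem memLp_pairMin_two {p q : X → ℝ} (hp0 : ∀ y, 0 ≤ p y) (hpm : Measurable p)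
    (hpi : Integrable p μ) (hq0 : ∀ y, 0 < q y) (hqm : Measurable q) :
    MemLp (fun z : X × X => min (p z.1 / q z.1) (p z.2 / q z.2)) 2
      ((μ.withDensity fun y => ENNReal.ofReal (q y)).prod
        (μ.withDensity fun y => ENNReal.ofReal (q y))) := by
  rw [memLp_two_iff_integrable_sq (PairedDraws.measurable_pairMin hpm hqm).aestronglyMeasurable,
    integrable_prod_withDensity_iff (fun y => (hq0 y).le) hqm]
  exact integrable_sq_pairMin_mul hp0 hpm hpi hq0 hqm

/-- **`μ_F = a`**: `∫ min(w, w′) d((q dμ) ⊗ (q dμ)) = acc(p, q)`. [ours] -/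
theorem integral_pairMin_withDensity_eq_meanAccept {p q : X → ℝ} (hp0 : ∀ y, 0 ≤ p y)
    (hpm : Measurable p) (hpi : Integrable p μ) (hq0 : ∀ y, 0 < q y) (hqm : Measurable q)
    (hqi : Integrable q μ) :
    ∫ z, min (p z.1 / q z.1) (p z.2 / q z.2) ∂(μ.withDensity fun y => ENNReal.ofReal (q y)).prod
        (μ.withDensity fun y => ENNReal.ofReal (q y))
      = ∫ a, ∫ b, min (p a * q b) (p b * q a) ∂μ ∂μ := by
  rw [integral_prod_withDensity_eq (fun y => (hq0 y).le) hqm]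
  exact PairedDraws.integral_pairMin_eq_meanAccept hp0 hpm hpi hq0 hqm hqi

/-- **`c₂ ≤ 1`**: `∫ min(w, w′)² d((q dμ) ⊗ (q dμ)) ≤ ∫∫ p ⊗ p = (∫ p)² = 1`. [ours] -/
theorem integral_sq_pairMin_withDensity_le_one {p q : X → ℝ} (hp0 : ∀ y, 0 ≤ p y)
    (hpm : Measurable p) (hpi : Integrable p μ) (hp1 : ∫ y, p y ∂μ = 1) (hq0 : ∀ y, 0 < q y)
    (hqm : Measurable q) :
    ∫ z, min (p z.1 / q z.1) (p z.2 / q z.2) ^ 2 ∂(μ.withDensity fun y => ENNReal.ofReal (q y)).prod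
        (μ.withDensity fun y => ENNReal.ofReal (q y)) ≤ 1 := by
  rw [integral_prod_withDensity_eq (fun y => (hq0 y).le) hqm]
  calc ∫ z, min (p z.1 / q z.1) (p z.2 / q z.2) ^ 2 * (q z.1 * q z.2) ∂(μ.prod μ)
      ≤ ∫ z, p z.1 * p z.2 ∂(μ.prod μ) := by
        refine integral_mono (integrable_sq_pairMin_mul hp0 hpm hpi hq0 hqm) (hpi.mul_prod hpi)
          fun z => ?_
        calc min (p z.1 / q z.1) (p z.2 / q z.2) ^ 2 * (q z.1 * q z.2)
            ≤ (p z.1 / q z.1) * (p z.2 / q z.2) * (q z.1 * q z.2) :=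
              mul_le_mul_of_nonneg_right (PairedDraws.sq_pairMin_le_mul hp0 hq0 z)
                (mul_nonneg (hq0 _).le (hq0 _).le)
          _ = p z.1 * p z.2 := by field_simp [(hq0 z.1).ne', (hq0 z.2).ne']
    _ = 1 := by rw [integral_prod_mul (fun a => p a) (fun b => p b), hp1, mul_one]

omit [SFinite μ] in
/-- The importance ratio is `q dμ`-integrable with `∫ w d(q dμ) = ∫ p dμ`. [ours] -/
theorem integral_weight_withDensity_eq {p q : X → ℝ} (hpi : Integrable p μ) (hq0 : ∀ y, 0 < q y)
    (hqm : Measurable q) :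
    Integrable (fun y => p y / q y) (μ.withDensity fun y => ENNReal.ofReal (q y)) ∧
    ∫ y, p y / q y ∂(μ.withDensity fun y => ENNReal.ofReal (q y)) = ∫ y, p y ∂μ := by
  have e : ∀ y, p y / q y * q y = p y := fun y => div_mul_cancel₀ _ (hq0 y).ne'
  constructor
  · rw [integrable_withDensity_iff' (fun y => (hq0 y).le) hqm]
    simp_rw [e]
    exact hpi
  · rw [integral_withDensity_eq' (fun y => (hq0 y).le) hqm]
    simp_rw [e]

omit [SFinite μ] in
/-- **`0 ≤ h ≤ 1`**: Hoeffding's projection of the kernel, `h(a) = ∫ min(w(a), w(b)) q(b) dμ(b)`,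
lies in `[0, ∫ p dμ] = [0, 1]`. [ours] -/
theorem condMean_pairMin_mem_Icc {p q : X → ℝ} (hp0 : ∀ y, 0 ≤ p y) (hpi : Integrable p μ)
    (hp1 : ∫ y, p y ∂μ = 1) (hq0 : ∀ y, 0 < q y) (hqm : Measurable q) (a : X) :
    0 ≤ ∫ b, min (p a / q a) (p b / q b) ∂(μ.withDensity fun y => ENNReal.ofReal (q y)) ∧
    ∫ b, min (p a / q a) (p b / q b) ∂(μ.withDensity fun y => ENNReal.ofReal (q y)) ≤ 1 := by
  have hw : ∀ y, 0 ≤ p y / q y := fun y => div_nonneg (hp0 y) (hq0 y).le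
  obtain ⟨hwi, hw1⟩ := integral_weight_withDensity_eq (μ := μ) hpi hq0 hqm
  refine ⟨integral_nonneg fun b => le_min (hw a) (hw b), ?_⟩
  calc ∫ b, min (p a / q a) (p b / q b) ∂(μ.withDensity fun y => ENNReal.ofReal (q y))
      ≤ ∫ b, p b / q b ∂(μ.withDensity fun y => ENNReal.ofReal (q y)) := by
        refine integral_mono_of_nonneg (Filter.Eventually.of_forall fun b => le_min (hw a) (hw b))
          hwi (Filter.Eventually.of_forall fun b => min_le_right _ _)
    _ = 1 := by rw [hw1, hp1]

/-- **`c₁ ≤ a`**: `∫ h² d(q dμ) ≤ ∫ h d(q dμ) = μ_F = acc(p, q)` since `0 ≤ h ≤ 1`. [ours] -/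
theorem integral_condMean_sq_pairMin_le_meanAccept {p q : X → ℝ} (hp0 : ∀ y, 0 ≤ p y)
    (hpm : Measurable p) (hpi : Integrable p μ) (hp1 : ∫ y, p y ∂μ = 1) (hq0 : ∀ y, 0 < q y)
    (hqm : Measurable q) (hqi : Integrable q μ)
    [IsProbabilityMeasure (μ.withDensity fun y => ENNReal.ofReal (q y))] :
    ∫ a, (∫ b, min (p a / q a) (p b / q b) ∂(μ.withDensity fun y => ENNReal.ofReal (q y))) ^ 2
        ∂(μ.withDensity fun y => ENNReal.ofReal (q y))
      ≤ ∫ a, ∫ b, min (p a * q b) (p b * q a) ∂μ ∂μ := by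
  have hF2 := memLp_pairMin_two (μ := μ) hp0 hpm hpi hq0 hqm
  have hh := memLp_condMean_two (F := fun a b => min (p a / q a) (p b / q b))
    (PairedDraws.measurable_pairMin hpm hqm) hF2
  calc ∫ a, (∫ b, min (p a / q a) (p b / q b) ∂(μ.withDensity fun y => ENNReal.ofReal (q y))) ^ 2
        ∂(μ.withDensity fun y => ENNReal.ofReal (q y))
      ≤ ∫ a, ∫ b, min (p a / q a) (p b / q b) ∂(μ.withDensity fun y => ENNReal.ofReal (q y))
        ∂(μ.withDensity fun y => ENNReal.ofReal (q y)) := by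
        refine integral_mono hh.integrable_sq (hh.integrable one_le_two) fun a => ?_
        obtain ⟨h0, h1⟩ := condMean_pairMin_mem_Icc (μ := μ) hp0 hpi hp1 hq0 hqm a
        simp only
        nlinarith
    _ = ∫ a, ∫ b, min (p a * q b) (p b * q a) ∂μ ∂μ := by
        rw [integral_condMean_eq (F := fun a b => min (p a / q a) (p b / q b)) hF2]
        exact integral_pairMin_withDensity_eq_meanAccept hp0 hpm hpi hq0 hqm hqi

/-- **`0 ≤ acc(p, q) ≤ 1`** on a general space, for a normalised target `p ≥ 0` and a model
density `q > 0` whose law `q dμ` is a probability measure (from `a² ≤ c₁ ≤ a`: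
`sq_kernelMean_le_condMeanSq` and `integral_condMean_sq_pairMin_le_meanAccept`). [ours] -/
theorem meanAccept_mem_Icc {p q : X → ℝ} (hp0 : ∀ y, 0 ≤ p y) (hpm : Measurable p)
    (hpi : Integrable p μ) (hp1 : ∫ y, p y ∂μ = 1) (hq0 : ∀ y, 0 < q y) (hqm : Measurable q)
    (hqi : Integrable q μ) [IsProbabilityMeasure (μ.withDensity fun y => ENNReal.ofReal (q y))] :
    0 ≤ ∫ a, ∫ b, min (p a * q b) (p b * q a) ∂μ ∂μ ∧
    ∫ a, ∫ b, min (p a * q b) (p b * q a) ∂μ ∂μ ≤ 1 := by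
  have ha0 : 0 ≤ ∫ a, ∫ b, min (p a * q b) (p b * q a) ∂μ ∂μ :=
    integral_nonneg fun a => integral_nonneg fun b =>
      le_min (mul_nonneg (hp0 a) (hq0 b).le) (mul_nonneg (hp0 b) (hq0 a).le)
  have hF2 := memLp_pairMin_two (μ := μ) hp0 hpm hpi hq0 hqm
  have hm1 := integral_condMean_sq_pairMin_le_meanAccept (μ := μ) hp0 hpm hpi hp1 hq0 hqm hqi
  have hsq := sq_kernelMean_le_condMeanSq (F := fun a b => min (p a / q a) (p b / q b))
    (PairedDraws.measurable_pairMin hpm hqm) hF2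
  rw [integral_pairMin_withDensity_eq_meanAccept hp0 hpm hpi hq0 hqm hqi] at hsq
  refine ⟨ha0, ?_⟩
  nlinarith [hsq.trans hm1, ha0]

/-! ## §2 The exact variance of `Û` and its sharp ceiling-free envelope -/

/-- **The EXACT variance of the all-pairs acceptance estimator** (Hoeffding's law for the kernel
`min(w, w′)`, general space): for `n ≥ 2` independent model draws,
`Var[Û] = (2(c₂ − a²) + 4(n − 2)(c₁ − a²)) / (n(n − 1))` with `a = acc(p, q)`,
`c₂ = ∫ min(w, w′)² d((q dμ)⊗(q dμ))`, `c₁ = ∫ h² d(q dμ)`. [ours] -/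
theorem variance_allPairs_eq {x : Fin n → Ω → X} (hxm : ∀ i, Measurable (x i))
    (hind : iIndepFun x P) {p q : X → ℝ} (hp0 : ∀ y, 0 ≤ p y) (hpm : Measurable p)
    (hpi : Integrable p μ) (hq0 : ∀ y, 0 < q y) (hqm : Measurable q) (hqi : Integrable q μ)
    (hlaw : ∀ i, Measure.map (x i) P = μ.withDensity fun y => ENNReal.ofReal (q y))
    (hn : 2 ≤ n) :
    Var[fun ω => (∑ z ∈ (univ : Finset (Fin n)).offDiag,
        min (p (x z.1 ω) / q (x z.1 ω)) (p (x z.2 ω) / q (x z.2 ω))) / (n * (n - 1) : ℝ); P]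
      = (2 * ((∫ z, min (p z.1 / q z.1) (p z.2 / q z.2) ^ 2
            ∂(μ.withDensity fun y => ENNReal.ofReal (q y)).prod
              (μ.withDensity fun y => ENNReal.ofReal (q y)))
            - (∫ a, ∫ b, min (p a * q b) (p b * q a) ∂μ ∂μ) ^ 2)
          + 4 * (n - 2) * ((∫ a, (∫ b, min (p a / q a) (p b / q b)
              ∂(μ.withDensity fun y => ENNReal.ofReal (q y))) ^ 2
              ∂(μ.withDensity fun y => ENNReal.ofReal (q y)))
            - (∫ a, ∫ b, min (p a * q b) (p b * q a) ∂μ ∂μ) ^ 2)) / (n * (n - 1)) := by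
  rw [variance_ustat₂_iid hxm hind hlaw (F := fun a b => min (p a / q a) (p b / q b))
      (PairedDraws.measurable_pairMin hpm hqm) (fun a b => min_comm _ _)
      (memLp_pairMin_two hp0 hpm hpi hq0 hqm) hn,
    integral_pairMin_withDensity_eq_meanAccept hp0 hpm hpi hq0 hqm hqi]

/-- **The SHARP ceiling-free envelope**: for EVERY target `p` (`∫ p = 1`) and model `q > 0` on
EVERY measurable space and `n ≥ 2` independent model draws,
`Var[Û] ≤ (2(1 − a²) + 4(n − 2)·a(1 − a)) / (n(n − 1))`, `a = acc(p, q)` (equality: the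
hit-or-miss flow, row 3's finite `exists_variance_pairMin_eq_sharp`). [ours] -/
theorem variance_allPairs_le_sharp {x : Fin n → Ω → X} (hxm : ∀ i, Measurable (x i))
    (hind : iIndepFun x P) {p q : X → ℝ} (hp0 : ∀ y, 0 ≤ p y) (hpm : Measurable p)
    (hpi : Integrable p μ) (hp1 : ∫ y, p y ∂μ = 1) (hq0 : ∀ y, 0 < q y) (hqm : Measurable q)
    (hqi : Integrable q μ)
    (hlaw : ∀ i, Measure.map (x i) P = μ.withDensity fun y => ENNReal.ofReal (q y))
    (hn : 2 ≤ n) :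
    Var[fun ω => (∑ z ∈ (univ : Finset (Fin n)).offDiag,
        min (p (x z.1 ω) / q (x z.1 ω)) (p (x z.2 ω) / q (x z.2 ω))) / (n * (n - 1) : ℝ); P]
      ≤ (2 * (1 - (∫ a, ∫ b, min (p a * q b) (p b * q a) ∂μ ∂μ) ^ 2)
          + 4 * (n - 2) * ((∫ a, ∫ b, min (p a * q b) (p b * q a) ∂μ ∂μ)
            * (1 - ∫ a, ∫ b, min (p a * q b) (p b * q a) ∂μ ∂μ))) / (n * (n - 1)) := by
  haveI := isProbabilityMeasure_of_map_eq_iid (hxm ⟨0, by omega⟩) (hlaw ⟨0, by omega⟩)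
  rw [variance_allPairs_eq hxm hind hp0 hpm hpi hq0 hqm hqi hlaw hn]
  have hm2 := integral_sq_pairMin_withDensity_le_one (μ := μ) hp0 hpm hpi hp1 hq0 hqm
  have hm1 := integral_condMean_sq_pairMin_le_meanAccept (μ := μ) hp0 hpm hpi hp1 hq0 hqm hqi
  have h2 : (2 : ℝ) ≤ n := by exact_mod_cast hn
  have hNpos : (0 : ℝ) < n * (n - 1) := by
    have : (0 : ℝ) < n := by linarith
    have : (0 : ℝ) < n - 1 := by linarith
    positivity
  refine div_le_div_of_nonneg_right ?_ hNpos.le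
  have h4 : (0 : ℝ) ≤ 4 * (n - 2) := by linarith
  nlinarith [mul_le_mul_of_nonneg_left hm1 h4]

/-- **Clean forms**: `Var[Û] ≤ 4a(1 − a)/n + 2(1 − a²)/(n(n − 1)) ≤ (n + 1)/(n(n − 1))` — so the
all-pairs acceptance error bar read off `n` fresh proposals is at most `√((n + 1)/(n − 1))/√n` for
every flow on every space, ceiling-free. [ours] -/
theorem variance_allPairs_le_sharp' {x : Fin n → Ω → X} (hxm : ∀ i, Measurable (x i))
    (hind : iIndepFun x P) {p q : X → ℝ} (hp0 : ∀ y, 0 ≤ p y) (hpm : Measurable p)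
    (hpi : Integrable p μ) (hp1 : ∫ y, p y ∂μ = 1) (hq0 : ∀ y, 0 < q y) (hqm : Measurable q)
    (hqi : Integrable q μ)
    (hlaw : ∀ i, Measure.map (x i) P = μ.withDensity fun y => ENNReal.ofReal (q y))
    (hn : 2 ≤ n) :
    Var[fun ω => (∑ z ∈ (univ : Finset (Fin n)).offDiag,
        min (p (x z.1 ω) / q (x z.1 ω)) (p (x z.2 ω) / q (x z.2 ω))) / (n * (n - 1) : ℝ); P]
      ≤ 4 * ((∫ a, ∫ b, min (p a * q b) (p b * q a) ∂μ ∂μ)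
            * (1 - ∫ a, ∫ b, min (p a * q b) (p b * q a) ∂μ ∂μ)) / n
        + 2 * (1 - (∫ a, ∫ b, min (p a * q b) (p b * q a) ∂μ ∂μ) ^ 2) / (n * (n - 1)) ∧
    4 * ((∫ a, ∫ b, min (p a * q b) (p b * q a) ∂μ ∂μ)
          * (1 - ∫ a, ∫ b, min (p a * q b) (p b * q a) ∂μ ∂μ)) / n
        + 2 * (1 - (∫ a, ∫ b, min (p a * q b) (p b * q a) ∂μ ∂μ) ^ 2) / (n * (n - 1))
      ≤ (n + 1) / (n * (n - 1)) := by
  haveI := isProbabilityMeasure_of_map_eq_iid (hxm ⟨0, by omega⟩) (hlaw ⟨0, by omega⟩)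
  obtain ⟨ha0, ha1⟩ := meanAccept_mem_Icc (μ := μ) hp0 hpm hpi hp1 hq0 hqm hqi
  set a := ∫ a, ∫ b, min (p a * q b) (p b * q a) ∂μ ∂μ with ha
  have ha01 : 0 ≤ a * (1 - a) := mul_nonneg ha0 (by linarith)
  have h2 : (2 : ℝ) ≤ n := by exact_mod_cast hn
  have hnpos : (0 : ℝ) < n := by linarith
  have hn1 : (0 : ℝ) < n - 1 := by linarith
  have hNpos : (0 : ℝ) < n * (n - 1) := mul_pos hnpos hn1
  constructor
  · have key : 2 * (1 - a ^ 2) + 4 * (n - 2) * (a * (1 - a))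
        ≤ 4 * (a * (1 - a)) * (n - 1) + 2 * (1 - a ^ 2) := by nlinarith [ha01]
    calc Var[fun ω => (∑ z ∈ (univ : Finset (Fin n)).offDiag,
          min (p (x z.1 ω) / q (x z.1 ω)) (p (x z.2 ω) / q (x z.2 ω))) / (n * (n - 1) : ℝ); P]
        ≤ (2 * (1 - a ^ 2) + 4 * (n - 2) * (a * (1 - a))) / (n * (n - 1)) :=
          variance_allPairs_le_sharp hxm hind hp0 hpm hpi hp1 hq0 hqm hqi hlaw hn
      _ ≤ (4 * (a * (1 - a)) * (n - 1) + 2 * (1 - a ^ 2)) / (n * (n - 1)) :=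
          div_le_div_of_nonneg_right key hNpos.le
      _ = 4 * (a * (1 - a)) / n + 2 * (1 - a ^ 2) / (n * (n - 1)) := by
          field_simp
  · have hq1 : 4 * (a * (1 - a)) ≤ 1 := by nlinarith [sq_nonneg (1 - 2 * a)]
    have hq2 : 2 * (1 - a ^ 2) ≤ 2 := by nlinarith [sq_nonneg a]
    calc 4 * (a * (1 - a)) / n + 2 * (1 - a ^ 2) / (n * (n - 1))
        ≤ 1 / n + 2 / (n * (n - 1)) :=
          add_le_add (div_le_div_of_nonneg_right hq1 hnpos.le)
            (div_le_div_of_nonneg_right hq2 hNpos.le)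
      _ = (n + 1) / (n * (n - 1)) := by
          field_simp
          ring

/-- **CHEBYSHEV, ceiling-free**: for every flow on every space, `n ≥ 2` independent model draws
and `t > 0`: `P(|Û − acc(p, q)| ≥ t) ≤ (n + 1)/(n(n − 1)t²)`. [ours] -/
theorem chebyshev_allPairs_sharp {x : Fin n → Ω → X} (hxm : ∀ i, Measurable (x i))
    (hind : iIndepFun x P) {p q : X → ℝ} (hp0 : ∀ y, 0 ≤ p y) (hpm : Measurable p)
    (hpi : Integrable p μ) (hp1 : ∫ y, p y ∂μ = 1) (hq0 : ∀ y, 0 < q y) (hqm : Measurable q)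
    (hqi : Integrable q μ)
    (hlaw : ∀ i, Measure.map (x i) P = μ.withDensity fun y => ENNReal.ofReal (q y))
    (hn : 2 ≤ n) {t : ℝ} (ht : 0 < t) :
    P {ω | t ≤ |(∑ z ∈ (univ : Finset (Fin n)).offDiag,
        min (p (x z.1 ω) / q (x z.1 ω)) (p (x z.2 ω) / q (x z.2 ω))) / (n * (n - 1))
          - ∫ a, ∫ b, min (p a * q b) (p b * q a) ∂μ ∂μ|}
      ≤ ENNReal.ofReal ((n + 1) / (n * (n - 1)) / t ^ 2) := by
  have hF2 := memLp_pairMin_two (μ := μ) hp0 hpm hpi hq0 hqm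
  have hU := memLp_ustat₂_iid hxm hind hlaw (F := fun a b => min (p a / q a) (p b / q b)) hF2
  have h := meas_ge_le_variance_div_sq hU ht
  have hm : ∫ ω, (fun ω => (∑ z ∈ (univ : Finset (Fin n)).offDiag,
      min (p (x z.1 ω) / q (x z.1 ω)) (p (x z.2 ω) / q (x z.2 ω))) / (n * (n - 1) : ℝ)) ω ∂P
      = ∫ a, ∫ b, min (p a * q b) (p b * q a) ∂μ ∂μ := by
    rw [integral_ustat₂_iid hxm hind hlaw (F := fun a b => min (p a / q a) (p b / q b))
        (PairedDraws.measurable_pairMin hpm hqm) hF2 hn]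
    exact integral_pairMin_withDensity_eq_meanAccept hp0 hpm hpi hq0 hqm hqi
  rw [hm] at h
  refine h.trans (ENNReal.ofReal_le_ofReal (div_le_div_of_nonneg_right ?_ (sq_nonneg t)))
  obtain ⟨h1, h2⟩ := variance_allPairs_le_sharp' hxm hind hp0 hpm hpi hp1 hq0 hqm hqi hlaw hn
  exact h1.trans h2

/-- The same Chebyshev certificate in `P.real` form:
`P.real(|Û − acc(p, q)| ≥ t) ≤ (n + 1)/(n(n − 1)t²)`. [ours] -/
theorem chebyshev_allPairs_sharp_real {x : Fin n → Ω → X} (hxm : ∀ i, Measurable (x i))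
    (hind : iIndepFun x P) {p q : X → ℝ} (hp0 : ∀ y, 0 ≤ p y) (hpm : Measurable p)
    (hpi : Integrable p μ) (hp1 : ∫ y, p y ∂μ = 1) (hq0 : ∀ y, 0 < q y) (hqm : Measurable q)
    (hqi : Integrable q μ)
    (hlaw : ∀ i, Measure.map (x i) P = μ.withDensity fun y => ENNReal.ofReal (q y))
    (hn : 2 ≤ n) {t : ℝ} (ht : 0 < t) :
    P.real {ω | t ≤ |(∑ z ∈ (univ : Finset (Fin n)).offDiag,
        min (p (x z.1 ω) / q (x z.1 ω)) (p (x z.2 ω) / q (x z.2 ω))) / (n * (n - 1))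
          - ∫ a, ∫ b, min (p a * q b) (p b * q a) ∂μ ∂μ|}
      ≤ (n + 1) / (n * (n - 1)) / t ^ 2 := by
  have h2 : (2 : ℝ) ≤ n := by exact_mod_cast hn
  have hnn : (0 : ℝ) ≤ (n + 1) / (n * (n - 1)) / t ^ 2 :=
    div_nonneg (div_nonneg (by linarith) (mul_nonneg (by linarith) (by linarith))) (sq_nonneg t)
  exact ENNReal.toReal_le_of_le_ofReal hnn
    (chebyshev_allPairs_sharp hxm hind hp0 hpm hpi hp1 hq0 hqm hqi hlaw hn ht)

/-- **A-vs-B ACCEPTANCE COMPARISON FROM ALL PAIRS, CEILING-FREE, CHEBYSHEV LEVEL.**  One normalised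
target `p ≥ 0`; two codes with model densities `q, q' > 0` (NO weight ceilings); code A supplies
`n ≥ 2` independent draws of its own (all-pairs estimate `Û`), code B supplies `n' ≥ 2` (`Û'`);
nothing is assumed between the two streams.  For `t, t' > 0`:
`P(t + t' ≤ |(Û − Û') − (acc(p,q) − acc(p,q'))|) ≤ (n + 1)/(n(n − 1)t²) + (n' + 1)/(n'(n' − 1)t'²)`.
[ours] -/
theorem acceptance_AB_allPairs_chebyshev {p q q' : X → ℝ} (hp0 : ∀ y, 0 ≤ p y)
    (hpm : Measurable p) (hpi : Integrable p μ) (hp1 : ∫ y, p y ∂μ = 1) (hq0 : ∀ y, 0 < q y)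
    (hqm : Measurable q) (hqi : Integrable q μ) (hq0' : ∀ y, 0 < q' y) (hqm' : Measurable q')
    (hqi' : Integrable q' μ) {n n' : ℕ} {x : Fin n → Ω → X} (hxm : ∀ i, Measurable (x i))
    (hind : iIndepFun x P)
    (hlaw : ∀ i, Measure.map (x i) P = μ.withDensity fun y => ENNReal.ofReal (q y))
    {z : Fin n' → Ω → X} (hzm : ∀ j, Measurable (z j)) (hindz : iIndepFun z P)
    (hlawz : ∀ j, Measure.map (z j) P = μ.withDensity fun y => ENNReal.ofReal (q' y))
    (hn : 2 ≤ n) (hn' : 2 ≤ n') {t t' : ℝ} (ht : 0 < t) (ht' : 0 < t') :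
    P.real {ω | t + t'
        ≤ |((∑ e ∈ (univ : Finset (Fin n)).offDiag,
                min (p (x e.1 ω) / q (x e.1 ω)) (p (x e.2 ω) / q (x e.2 ω))) / (n * (n - 1))
            - (∑ e ∈ (univ : Finset (Fin n')).offDiag,
                min (p (z e.1 ω) / q' (z e.1 ω)) (p (z e.2 ω) / q' (z e.2 ω))) / (n' * (n' - 1)))
            - ((∫ a, ∫ b, min (p a * q b) (p b * q a) ∂μ ∂μ)
              - ∫ a, ∫ b, min (p a * q' b) (p b * q' a) ∂μ ∂μ)|}
      ≤ (n + 1) / (n * (n - 1)) / t ^ 2 + (n' + 1) / (n' * (n' - 1)) / t' ^ 2 := by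
  have hA := chebyshev_allPairs_sharp_real hxm hind hp0 hpm hpi hp1 hq0 hqm hqi hlaw hn ht
  have hB := chebyshev_allPairs_sharp_real hzm hindz hp0 hpm hpi hp1 hq0' hqm' hqi' hlawz hn' ht'
  set acc : ℝ := ∫ a, ∫ b, min (p a * q b) (p b * q a) ∂μ ∂μ
  set acc' : ℝ := ∫ a, ∫ b, min (p a * q' b) (p b * q' a) ∂μ ∂μ
  set U : Ω → ℝ := fun ω => (∑ e ∈ (univ : Finset (Fin n)).offDiag,
    min (p (x e.1 ω) / q (x e.1 ω)) (p (x e.2 ω) / q (x e.2 ω))) / (n * (n - 1))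
  set U' : Ω → ℝ := fun ω => (∑ e ∈ (univ : Finset (Fin n')).offDiag,
    min (p (z e.1 ω) / q' (z e.1 ω)) (p (z e.2 ω) / q' (z e.2 ω))) / (n' * (n' - 1))
  have hsub : {ω | t + t' ≤ |(U ω - U' ω) - (acc - acc')|}
      ⊆ {ω | t ≤ |U ω - acc|} ∪ {ω | t' ≤ |U' ω - acc'|} := by
    intro ω hω
    simp only [Set.mem_setOf_eq, Set.mem_union] at hω ⊢
    by_contra hcon
    obtain ⟨h1, h2⟩ := not_or.mp hcon
    have : |(U ω - U' ω) - (acc - acc')| ≤ |U ω - acc| + |U' ω - acc'| := by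
      rw [show (U ω - U' ω) - (acc - acc') = (U ω - acc) - (U' ω - acc') by ring]
      exact abs_sub _ _
    linarith [not_le.mp h1, not_le.mp h2]
  calc P.real {ω | t + t' ≤ |(U ω - U' ω) - (acc - acc')|}
      ≤ P.real ({ω | t ≤ |U ω - acc|} ∪ {ω | t' ≤ |U' ω - acc'|}) := measureReal_mono hsub
    _ ≤ P.real {ω | t ≤ |U ω - acc|} + P.real {ω | t' ≤ |U' ω - acc'|} :=
        measureReal_union_le _ _
    _ ≤ _ := add_le_add hA hB

end Summit.Ventures.LatticeQCDFlow.Scoring.AllPairsVariance
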